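/-
Copyright: cell `pub-ymgap` (HUMAN RULING D-0062), Track A of `YM-PLAN.md`, DAG node N20 (= NE7b); R134 acceleration seat
`pub-ymgap-dag-n20-d` (generation 3), module 2.  Released under the licence of the surrounding project.
-/
import Literature.MathematicalPhysics.QuantumFieldTheory.Balaban1983to89.TorusGeometry
import HarnessLib

/-!
# YM-DAG node N20 (= NE7b): THE BOX REGIONS OF THE DOMINATION LETTER — the fine plaquettes cornered in the `ℓ∞`-ball of radius `ρ` around a
# site, their number `≤ (2ρ+1)^d·d²`, and the MULTIPLICITY with which a fine plaquette is charged by the coarse plaquettes (`≤ (2ρ+1)^d·d²`)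
# — the `R P`, `n`, `m` of the (LS)₀ ⇒ (LS)₁ transfer for Bałaban's block averaging (pure torus geometry)

Track A of `YM-PLAN.md` (cell `pub-ymgap`, HUMAN RULING D-0062), node **N20** = spine estimate NE7b (`T4WeightBudget.RelWeightBound`, NOT PRINTED,
NOT PROVED).  Seat `pub-ymgap-dag-n20-d` (R134), generation 3, module 2 (module 1: `…Theorems.BalabanUVNodesN20LCSAvgDomination`, the domination
letter for the (0.4) averaging `avgFun expMeanLogSU`, stated for ANY finite set `R` of fine plaquettes containing those cornered in the `ℓ∞`-ball of
radius `(d+3)L + 2` around the block centre `emb p′₋`).  ONE definition + kernel theorems; 0 `sorry`; standard axioms; COUNT-NEUTRAL.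

WHY.  The consumer of the letter — seat `pub-ymgap-dag-n20-c`'s transfer `N20LCSPushforward.localExpMoment_blockMap` (local exponential
plaquette moments of a block-mapped field under the bare Wilson measure) — needs, besides the pointwise letter `hdom`, a region map `R` with
(a) a uniform SIZE bound `#(R P) ≤ n` and (b) a uniform MULTIPLICITY bound `#{P ∈ Q : q ∈ R P} ≤ m` (the tilt per fine plaquette is `m·a`).
THIS FILE supplies the canonical regions and both counts, as torus geometry with no gauge field and no measure:

* `boxRegion x ρ` — the finite set of plaquettes `q` of `T^{(j)}` whose corner lies in the `ℓ∞`-ball of radius `ρ` around `x`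
  (`∀ ν, ∃ e : ℤ, |e| ≤ ρ ∧ q₋ ν = x ν + e`; `mem_boxRegion`), the hypothesis shape of module 1's `one_sub_reTr_plaqHol_avgFun_le_mul_sum_of_box` and
  of `HistoryTailWalkLocality.walkLocal_of_box`;
* **`card_boxRegion_le`** — `#(boxRegion x ρ) ≤ (2ρ+1)^d · d²` (the offset vector and the two directions determine the plaquette; the torus may
  be smaller than the box — the bound counts labels, not sites);
* **`card_filter_mem_boxRegion_emb_le`** — MULTIPLICITY (standing range `j + 1 ≤ m + K`): for every fine plaquette `q` and every finite family `Q`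
  of coarse plaquettes, `#{P ∈ Q : q ∈ boxRegion (emb P₋) ρ} ≤ (2ρ+1)^d · d²` (`q₋ = emb P₋ + e` pins `emb P₋`, and `emb` is injective on
  `T^{(j+1)}` by `Site.blockOf_emb`).

HONEST FRAMING.  Bookkeeping for the letter's consumer; crude counts (`d²` for the `d(d−1)/2` direction pairs).  NE7b NOT PRINTED ∕ NOT PROVED;
(α)-instance 0∕1; N20 NOT discharged; typed 28∕28, discharged count untouched; one finite four-torus at fixed `ε` — NOT ℝ⁴, NOT infinite
volume, NOT OS, NOT a mass gap, NOT Clay.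

References: T. Bałaban, CMP 109 (1987) 249–301 [Balaban1987RG1] ((0.1)–(0.3) pp.251–252: the tori `T^{(j)}`, blocks and centres).
-/

noncomputable section

open scoped BigOperators

namespace Summit.QuantumFields.YangMills.BalabanUVNodes.N20LCSAvgDominationRegion

open Literature.MathematicalPhysics.QuantumFieldTheory.Balaban1983to89


variable {P : Params} {j : ℕ}

/-! ## §1 The box regions -/

open scoped Classical in
/-- THE BOX REGION of radius `ρ` around a site `x` of `T^{(j)}`: the plaquettes whose corner has every coordinate of the form `x ν + e`, `e ∈ ℤ`,
`|e| ≤ ρ`. [cite: Balaban1987RG1, (0.3) p.252] -/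
def boxRegion (x : Site P j) (ρ : ℕ) : Finset (Plaq P j) :=
  Finset.univ.filter fun q => ∀ ν, ∃ e : ℤ, |e| ≤ (ρ : ℤ) ∧ q.src ν = x ν + (e : ZMod (P.sitesPerDir j))

/-- Membership in the box region. [folklore] -/
theorem mem_boxRegion {x : Site P j} {ρ : ℕ} {q : Plaq P j} :
    q ∈ boxRegion x ρ ↔ ∀ ν, ∃ e : ℤ, |e| ≤ (ρ : ℤ) ∧ q.src ν = x ν + (e : ZMod (P.sitesPerDir j)) := by
  classical
  simp only [boxRegion, Finset.mem_filter, Finset.mem_univ, true_and]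

/-- The hypothesis shape of the letter: every plaquette cornered in the box belongs to the box region. [folklore] -/
theorem mem_boxRegion_of_corner {x : Site P j} {ρ : ℕ} (z : Site P j)
    (hz : ∀ ν, ∃ e : ℤ, |e| ≤ (ρ : ℤ) ∧ z ν = x ν + (e : ZMod (P.sitesPerDir j))) (a b : Fin P.d) (h : a < b) :
    (⟨z, a, b, h⟩ : Plaq P j) ∈ boxRegion x ρ :=
  mem_boxRegion.mpr hz

/-! ## §2 Counting: labels by (offset vector, two directions) -/

/-- Two plaquettes with the same corner and directions are equal. [folklore] -/
private theorem plaq_eq_of {q₁ q₂ : Plaq P j} (hs : q₁.src = q₂.src) (hμ : q₁.μ = q₂.μ) (hν : q₁.ν = q₂.ν) : q₁ = q₂ := by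
  cases q₁; cases q₂
  simp only at hs hμ hν
  subst hs; subst hμ; subst hν
  rfl

/-- The label space `{0,…,2ρ}^d × (directions)²` has `(2ρ+1)^d·d²` elements. [folklore] -/
private theorem card_labels (d ρ : ℕ) :
    Fintype.card ((Fin d → Fin (2 * ρ + 1)) × Fin d × Fin d) = (2 * ρ + 1) ^ d * d ^ 2 := by
  simp only [Fintype.card_prod, Fintype.card_fun, Fintype.card_fin]
  ring

/-- **A GENERIC COUNT**: a finite family of plaquettes of `T^{(k)}`, each carrying an offset vector `e q ∈ [−ρ, ρ]^d` that together with the two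
directions DETERMINES the plaquette, has at most `(2ρ+1)^d·d²` members. [folklore] -/
theorem card_le_of_offset_labels {k : ℕ} (S : Finset (Plaq P k)) (ρ : ℕ) (e : Plaq P k → Fin P.d → ℤ)
    (he : ∀ q ∈ S, ∀ ι, |e q ι| ≤ (ρ : ℤ))
    (hinj : ∀ q₁ ∈ S, ∀ q₂ ∈ S, e q₁ = e q₂ → q₁.μ = q₂.μ → q₁.ν = q₂.ν → q₁ = q₂) :
    S.card ≤ (2 * ρ + 1) ^ P.d * P.d ^ 2 := by
  classical
  let f : Plaq P k → (Fin P.d → Fin (2 * ρ + 1)) × Fin P.d × Fin P.d := fun q =>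
    (fun ι => ⟨min (e q ι + ρ).toNat (2 * ρ), by omega⟩, q.μ, q.ν)
  have hcard : S.card ≤ (Finset.univ : Finset ((Fin P.d → Fin (2 * ρ + 1)) × Fin P.d × Fin P.d)).card := by
    refine Finset.card_le_card_of_injOn f (fun q _ => Finset.mem_univ _) ?_
    intro q₁ hq₁ q₂ hq₂ hf
    have hq₁' : q₁ ∈ S := Finset.mem_coe.mp hq₁
    have hq₂' : q₂ ∈ S := Finset.mem_coe.mp hq₂
    have hμ : q₁.μ = q₂.μ := by have := congrArg (fun g => g.2.1) hf; simpa [f] using this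
    have hν : q₁.ν = q₂.ν := by have := congrArg (fun g => g.2.2) hf; simpa [f] using this
    refine hinj q₁ hq₁' q₂ hq₂' (funext fun ι => ?_) hμ hν
    have hfι : min (e q₁ ι + ρ).toNat (2 * ρ) = min (e q₂ ι + ρ).toNat (2 * ρ) := by
      have := congrArg (fun g => ((g.1 ι : Fin (2 * ρ + 1)) : ℕ)) hf
      simpa [f] using this
    have h1 := abs_le.mp (he q₁ hq₁' ι)
    have h2 := abs_le.mp (he q₂ hq₂' ι)
    have hm1 : min (e q₁ ι + ρ).toNat (2 * ρ) = (e q₁ ι + ρ).toNat := min_eq_left (by omega)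
    have hm2 : min (e q₂ ι + ρ).toNat (2 * ρ) = (e q₂ ι + ρ).toNat := min_eq_left (by omega)
    rw [hm1, hm2] at hfι
    omega
  rwa [Finset.card_univ, card_labels] at hcard

/-- **THE SIZE OF A BOX REGION**: `#(boxRegion x ρ) ≤ (2ρ+1)^d · d²`. [cite: Balaban1987RG1, (0.3) p.252] -/
theorem card_boxRegion_le (x : Site P j) (ρ : ℕ) : (boxRegion x ρ).card ≤ (2 * ρ + 1) ^ P.d * P.d ^ 2 := by
  have hoff : ∀ q ∈ boxRegion x ρ, ∀ ι, ∃ e : ℤ, |e| ≤ (ρ : ℤ) ∧ q.src ι = x ι + (e : ZMod (P.sitesPerDir j)) :=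
    fun q hq => mem_boxRegion.mp hq
  choose! e he hsrc using hoff
  refine card_le_of_offset_labels _ ρ e (fun q hq ι => he q hq ι) fun q₁ hq₁ q₂ hq₂ hee hμ hν => ?_
  refine plaq_eq_of (funext fun ι => ?_) hμ hν
  rw [hsrc q₁ hq₁ ι, hsrc q₂ hq₂ ι, hee]

/-! ## §3 Multiplicity: how many coarse plaquettes charge a given fine plaquette -/

open scoped Classical in
/-- **THE MULTIPLICITY OF THE BOX REGIONS AROUND THE BLOCK CENTRES** (standing range `j + 1 ≤ m + K`): a fine plaquette `q` lies in
`boxRegion (emb P₋) ρ` for at most `(2ρ+1)^d · d²` coarse plaquettes `P` of any finite family `Q` — `q₋ ν = (emb P₋) ν + e` pins `emb P₋ = q₋ − e`,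
and `emb` is injective (`Site.blockOf_emb`). [cite: Balaban1987RG1, (0.1)-(0.3) pp.251-252] -/
theorem card_filter_mem_boxRegion_emb_le (hj : j + 1 ≤ P.m + P.K) (Q : Finset (Plaq P (j + 1))) (q : Plaq P j) (ρ : ℕ) :
    (Q.filter fun p : Plaq P (j + 1) => q ∈ boxRegion (emb p.src) ρ).card ≤ (2 * ρ + 1) ^ P.d * P.d ^ 2 := by
  classical
  set T := Q.filter fun p : Plaq P (j + 1) => q ∈ boxRegion (emb p.src) ρ with hT
  have hoff : ∀ p ∈ T, ∀ ι, ∃ e : ℤ, |e| ≤ (ρ : ℤ) ∧ q.src ι = (emb p.src) ι + (e : ZMod (P.sitesPerDir j)) := by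
    intro p hp
    exact mem_boxRegion.mp (Finset.mem_filter.mp hp).2
  choose! e he hsrc using hoff
  refine card_le_of_offset_labels T ρ e (fun p hp ι => he p hp ι) fun p₁ hp₁ p₂ hp₂ hee hμ hν => ?_
  have hemb : emb p₁.src = emb p₂.src := by
    funext ι
    have h₁ := hsrc p₁ hp₁ ι
    have h₂ := hsrc p₂ hp₂ ι
    rw [hee] at h₁
    -- `q₋ ι = emb p₁₋ ι + e = emb p₂₋ ι + e`
    have := h₁.symm.trans h₂
    exact add_right_cancel this
  have hsrc' : p₁.src = p₂.src := by
    rw [← Site.blockOf_emb hj p₁.src, ← Site.blockOf_emb hj p₂.src, hemb]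
  exact plaq_eq_of hsrc' hμ hν

open scoped Classical in
/-- The same bound for the number of ALL coarse plaquettes charging `q`. [cite: Balaban1987RG1, (0.1)-(0.3) pp.251-252] -/
theorem card_univ_filter_mem_boxRegion_emb_le (hj : j + 1 ≤ P.m + P.K) (q : Plaq P j) (ρ : ℕ) :
    ((Finset.univ : Finset (Plaq P (j + 1))).filter fun p : Plaq P (j + 1) => q ∈ boxRegion (emb p.src) ρ).card ≤ (2 * ρ + 1) ^ P.d * P.d ^ 2 :=
  card_filter_mem_boxRegion_emb_le hj Finset.univ q ρ

end Summit.QuantumFields.YangMills.BalabanUVNodes.N20LCSAvgDominationRegion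

end
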